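import Summits.QuantumFields.BalabanUV.Beta.GAN24.SavgEntryDecay
import Summits.QuantumFields.BalabanUV.Beta.GAN24.BlockFieldDecay
import Summits.QuantumFields.BalabanUV.T4Continuum.Support.ScalarAveragedCompressionSharp
import Summits.QuantumFields.BalabanUV.Beta.AccretiveCombesThomasBudget
import Literature.MathematicalPhysics.QuantumFieldTheory.Balaban1983to89.B5DPD126Uniform

/-!
# G-an2-4 ∕ (CONV-C), road P2 — INTERFACE REQUEST (U-SINV), file 2 of 2, THE END: THE UNIT-LATTICE INVERSE `S⁻¹ = (a′Q′G′Q′*)⁻¹` IS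
# BOUNDED AND EXPONENTIALLY LOCALISED, UNIFORMLY IN `n = η⁻¹` AND IN THE TORUS —
# `‖S⁻¹(y,y′)‖ ≤ σ_S(d,a′)·e^{−δ_S(d,a′)·|y − y′|_T}`, `RowDecay M id id S⁻¹ σ_S δ_S`, `|S⁻¹v|_∞ ≤ σ_∞(d,a′)·|v|_∞`

G-an2-4 formalisation swarm, leaf seat `b2b-balaban-gan24-formalise-leaf-03` (gen 49), answering the road-P2 owner `b2b-balaban-gan24-p2`
(gen 29)'s «INTERFACE REQUEST G-an2-4: (U-SINV, for the HARD minimiser, MEDIUM)» (`HOME/INBOX.md` 2026-08-21T09:07Z): «the unit-lattice inverse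
`S_n⁻¹ = (a′Q′G′_nQ′*)⁻¹` (`HardMinimiserOneStepSup.Savg` …) on cubic unit tori, n-UNIFORM: sup form `∃ σ > 0, ∀ n N₀ ≥ 1, ∀ v b, |v| ≤ b →
∀ y, ‖((Savg n (fun _ => N₀) a′)⁻¹ *ᵥ v) y‖ ≤ σ·b` (binders `hS`, `hS′` of `norm_Mhard_succ_sub_stair_le_of_letters`) and kernel form
`‖(Savg n _ a′)⁻¹ y y′‖ ≤ σ·e^{−δ·torusSupNorm M (rep y − rep y′)}` (binder `RowDecay M id id (Savg n M a′)⁻¹ σ δ` of `fieldDecay_Mhard_succ_sub_stair`)».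
DELIVERED HERE for EVERY torus `M : Fin (d+1) → ℕ` (cubic or not), every `n ≥ 1`, every `a′ > 0`, with constants FUNCTIONS OF `(d, a′)` ONLY.

ROUTE (ours): COMBES–THOMAS ON THE UNIT TORUS for the Hermitian matrix `S = Savg n M a′`:
 * §1 `S = a′ • Scomp` (`HardMinimiserOneStepSup.Savg_eq` ∕ `ScalarAveragedCompression.Scomp`), hence `S` is Hermitian and UNIFORMLY COERCIVE,
   **`re_form_Savg_ge`**: `a′σ₁(d+1,a′)·‖z‖² ≤ Re z*Sz` — the NE2 lane's plateau bound `ScalarAveragedCompressionSharp.form_Scomp_ge_sharp` BY NAME;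
 * §2 the one new estimate of the Combes–Thomas budget: a SMALL-RATE cosh defect bound for an exponentially localised Hermitian kernel,
   **`ctRowDefect_le_of_decay_small`**: `‖H(e,e′)‖ ≤ θe^{−κ₀d}`, `ρ` `d`-Lipschitz, `0 ≤ κ ≤ κ₀/4` ⇒ `defect ≤ (2θL/κ₀)·κ` with the profile
   `Σ_{e′} e^{−(κ₀/4)d(e,e′)} ≤ L` (via `cosh t − 1 ≤ e^{|t|} − 1 ≤ |t|e^{|t|}` and `t ≤ (2/κ₀)e^{κ₀t/2}`) — the substrate's `ctRowDefect_le_of_decay`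
   bounds the same defect by `θL`, which does not shrink with `κ`;
 * §3 the assembly: entry decay of `S` (`SavgEntryDecay.norm_Savg_apply_le`, file 1), the volume-free torus sum `EffectiveKernel.sum_exp_ldist_le`,
   the cosh budget `AccretiveCombesThomasBudget.conjLower_of_isHermitian`, `AccretiveCombesThomas.conjCoercive_of_conjLower` and the entrywise
   localisation `AccretiveCombesThomas.norm_inv_apply_le` along the weights `|· − y′|_T`: **`norm_Savg_inv_apply_le`**
   `‖S⁻¹(y,y′)‖ ≤ σ_S·e^{−δ_S·ldist M y y′}`, `σ_S = 2/(a′σ₁)`, `δ_S = min(κ_S/4, a′σ₁κ_S/(4θ_S L_S))`;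
 * §4 the requester's currencies: `ldist M y y′ = torusSupNorm M (rep M y − rep M y′)` (`B5DPD126Uniform.tdist_eq_torusSupNorm`),
   **`rowDecay_Savg_inv`** (`RowDecay M id id (Savg n M a′)⁻¹ σ_S δ_S`), **`norm_Savg_inv_mulVec_le`** (`|S⁻¹v|_∞ ≤ σ_S·K_{d+1}(δ_S)·|v|_∞`), and
   the two packaged existentials **`exists_rowDecay_Savg_inv`**, **`exists_sup_Savg_inv`** (constants chosen BEFORE `n`, `M`);
 * §5 **`norm_Mhard_succ_sub_stair_le_of_letters_uniform`**: the requester's sup END `HardMinimiserOneStepSup.norm_Mhard_succ_sub_stair_le_of_letters`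
   with its two unit-lattice binders `hS`, `hS′` DISCHARGED (`σ = σ′ = σ_∞(d,a′)`, level-free) — only the five fine-lattice letters remain displayed.

HONEST SCOPE.  [folklore] finite linear algebra over the tree's Combes–Thomas engine and coercivity bound; the decay rate is EXISTENTIAL in
size (it inherits `κ_S` = a `Classical.choose` of file 1 and the crude `γ′`, `σ₁`); scalar `U = 1` prototype; an INPUT of road P2's
hard-minimiser ENDs (`HardMinimiserOneStepSup` §3, `MinimiserOneStepDecay` §4), which stay the requester's; discharges NOTHING of (CONV-C) as
typed; NEVER «G-an2-4 closed»; NOT NE2, NOT D1, NOT BetaPertH, NOT continuum, NOT Clay; no `def … : Prop`, no cited fact, 0 sorry — not in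
print, our proof.  HONEST DEPENDENCY: continuum YM on T⁴ ⇐ BetaPertH ∧ nine spine estimates (0/9 proved); BetaPertH ⇐ (D1) ∧ (D4) ∧ CAP+tail;
G-an2-4 gates asym, D1 and NE2/3/4.
-/

noncomputable section

open scoped BigOperators ComplexConjugate Matrix ComplexOrder
open Finset

namespace Summit.QuantumFields.BalabanUV.Beta.GAN24.SavgInverseUniform

open Literature.MathematicalPhysics.QuantumFieldTheory.Balaban1983to89
open B5Prop11Plancherel (Tor fine)
open B5Prop11Lower (nsq nsq_nonneg)
open B4TorusKernel.MultiPeriod (torusSupNorm torusSupNorm_nonneg)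
open B4Sect5Proof (latticeConst latticeConst_nonneg)
open B6LowerBound2153Torus (rep)
open Beta.TorusG0Decay (ldist toSite ldist_self ldist_symm ldist_triangle)
open Beta.EffectiveKernel (sum_exp_ldist_le)
open Beta.DeltaACombesThomas (ctWeight ctRowDefect ctWeight_nonneg)
open B5DPD126Uniform (tdist_eq_torusSupNorm)
open Summit.QuantumFields.BalabanUV.T4Continuum
open Summit.QuantumFields.BalabanUV.T4Continuum.ScalarAveragedPropagator (Gps gammaPs gammaPs_pos)
open Summit.QuantumFields.BalabanUV.T4Continuum.ScalarAveragedCompression (Scomp Scomp_isHermitian)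
open Summit.QuantumFields.BalabanUV.T4Continuum.ScalarAveragedCompressionSharp (sigma1 sigma1_pos form_Scomp_ge_sharp)
open Summit.QuantumFields.BalabanUV.Beta.AccretiveCombesThomas (conjForm norm_inv_apply_le conjCoercive_of_conjLower conjLower_mono)
open Summit.QuantumFields.BalabanUV.Beta.AccretiveCombesThomasBudget (conjLower_of_isHermitian ctWeight_le_of_abs_sub_le)
open Summit.QuantumFields.BalabanUV.Beta.GAN24.HardMinimiserOneStepSup (Savg Savg_eq isUnit_det_Savg)
open Summit.QuantumFields.BalabanUV.Beta.GAN24.SavgEntryDecay (kappaS kappaS_pos kappaS_le_one thetaS thetaS_pos norm_Savg_apply_le)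
open Summit.QuantumFields.BalabanUV.Beta.GAN24.BlockFieldDecay (RowDecay)

variable {d : ℕ}

/-! ## §1 `S` is Hermitian and uniformly coercive -/

section Coercive

variable (n : ℕ) [NeZero n] (M : Fin d → ℕ) [hM : ∀ μ, NeZero (M μ)]

/-- `S = a′ • (Q′G′Q′*)`. [folklore] -/
theorem Savg_eq_smul_Scomp (a' : ℝ) : Savg n M a' = (a' : ℂ) • Scomp n M a' := by
  rw [Savg_eq, Scomp, smul_smul]

/-- `S` is Hermitian. [folklore] -/
theorem Savg_isHermitian (a' : ℝ) : (Savg n M a').IsHermitian := by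
  have h := (Scomp_isHermitian n M (a' := a')).eq
  unfold Matrix.IsHermitian
  rw [Savg_eq_smul_Scomp, Matrix.conjTranspose_smul, h, Complex.star_def, Complex.conj_ofReal]

/-- **`S` IS UNIFORMLY COERCIVE**: `a′σ₁(d,a′)·‖z‖² ≤ Re z*Sz` for every `n`, every torus (`σ₁ = ScalarAveragedCompressionSharp.sigma1`). [folklore] -/
theorem re_form_Savg_ge {a' : ℝ} (ha' : 0 < a') (z : Tor M → ℂ) :
    a' * sigma1 d a' * nsq z ≤ (star z ⬝ᵥ (Savg n M a' *ᵥ z)).re := by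
  rw [Savg_eq_smul_Scomp, Matrix.smul_mulVec, dotProduct_smul, smul_eq_mul, Complex.re_ofReal_mul, mul_assoc]
  exact mul_le_mul_of_nonneg_left (form_Scomp_ge_sharp n M ha' z) ha'.le

end Coercive

/-! ## §2 A small-rate cosh defect bound for exponentially localised Hermitian kernels -/

section Budget

variable {ι : Type*} [Fintype ι]

/-- **SMALL-RATE DEFECT FROM EXPONENTIAL LOCALISATION**: if `‖H(e,e′)‖ ≤ θe^{−κ₀ d(e,e′)}` with `d ≥ 0`, the weight `ρ` is `d`-Lipschitz,
`0 ≤ κ ≤ κ₀/4`, and `Σ_{e′} e^{−(κ₀/4)d(e,e′)} ≤ L`, then the cosh row defect is `≤ (2θL/κ₀)·κ` — it VANISHES linearly as `κ → 0`. [folklore] -/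
theorem ctRowDefect_le_of_decay_small (H : Matrix ι ι ℂ) {κ κ₀ θ L : ℝ} (hκ : 0 ≤ κ) (hκ₀ : 0 < κ₀) (hκs : κ ≤ κ₀ / 4) (hθ : 0 ≤ θ)
    (ρ : ι → ℝ) (dist : ι → ι → ℝ) (hd0 : ∀ e e', 0 ≤ dist e e') (hρ : ∀ e e', |ρ e - ρ e'| ≤ dist e e')
    (hH : ∀ e e', ‖H e e'‖ ≤ θ * Real.exp (-(κ₀ * dist e e'))) (hL : ∀ e, ∑ e', Real.exp (-(κ₀ / 4 * dist e e')) ≤ L) (e : ι) :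
    ctRowDefect H κ ρ e ≤ 2 * θ * L / κ₀ * κ := by
  have hc2 : 0 < κ₀ / 2 := by positivity
  -- pointwise: weight ≤ κ·(2/κ₀)·e^{(κ₀/2 + κ)·d}
  have hw : ∀ e', ctWeight κ ρ e e' ≤ κ * (κ₀ / 2)⁻¹ * Real.exp ((κ₀ / 2 + κ) * dist e e') := by
    intro e'
    have h1 : ctWeight κ ρ e e' ≤ Real.exp (κ * dist e e') - 1 := ctWeight_le_of_abs_sub_le hκ (hρ e e')
    -- `e^x − 1 ≤ x·e^x` (from `1 − x ≤ e^{−x}`) and `t ≤ (2/κ₀)·e^{(κ₀/2)t}` (from `1 + s ≤ e^s`)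
    have h2 : Real.exp (κ * dist e e') - 1 ≤ κ * dist e e' * Real.exp (κ * dist e e') := by
      have h := Real.add_one_le_exp (-(κ * dist e e'))
      have hpos := Real.exp_pos (κ * dist e e')
      have h1 : Real.exp (-(κ * dist e e')) * Real.exp (κ * dist e e') = 1 := by
        rw [← Real.exp_add, neg_add_cancel, Real.exp_zero]
      nlinarith
    have h3 : dist e e' ≤ (κ₀ / 2)⁻¹ * Real.exp (κ₀ / 2 * dist e e') := by
      have h := Real.add_one_le_exp (κ₀ / 2 * dist e e')
      rw [le_inv_mul_iff₀ hc2]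
      linarith
    calc ctWeight κ ρ e e' ≤ κ * dist e e' * Real.exp (κ * dist e e') := h1.trans h2
      _ ≤ κ * ((κ₀ / 2)⁻¹ * Real.exp (κ₀ / 2 * dist e e')) * Real.exp (κ * dist e e') := by gcongr
      _ = κ * (κ₀ / 2)⁻¹ * Real.exp ((κ₀ / 2 + κ) * dist e e') := by
          rw [show (κ₀ / 2 + κ) * dist e e' = κ₀ / 2 * dist e e' + κ * dist e e' by ring, Real.exp_add]; ring
  calc ctRowDefect H κ ρ e = ∑ e', ‖H e e'‖ * ctWeight κ ρ e e' := rfl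
    _ ≤ ∑ e', θ * Real.exp (-(κ₀ * dist e e')) * (κ * (κ₀ / 2)⁻¹ * Real.exp ((κ₀ / 2 + κ) * dist e e')) := by
        refine Finset.sum_le_sum fun e' _ => ?_
        exact mul_le_mul (hH e e') (hw e') (ctWeight_nonneg κ ρ e e') (mul_nonneg hθ (Real.exp_pos _).le)
    _ = 2 * θ / κ₀ * κ * ∑ e', Real.exp (-((κ₀ / 2 - κ) * dist e e')) := by
        rw [Finset.mul_sum]
        refine Finset.sum_congr rfl fun e' _ => ?_
        have : Real.exp (-(κ₀ * dist e e')) * Real.exp ((κ₀ / 2 + κ) * dist e e') = Real.exp (-((κ₀ / 2 - κ) * dist e e')) := by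
          rw [← Real.exp_add]; ring_nf
        calc θ * Real.exp (-(κ₀ * dist e e')) * (κ * (κ₀ / 2)⁻¹ * Real.exp ((κ₀ / 2 + κ) * dist e e'))
            = θ * (κ * (κ₀ / 2)⁻¹) * (Real.exp (-(κ₀ * dist e e')) * Real.exp ((κ₀ / 2 + κ) * dist e e')) := by ring
          _ = 2 * θ / κ₀ * κ * Real.exp (-((κ₀ / 2 - κ) * dist e e')) := by rw [this]; ring
    _ ≤ 2 * θ / κ₀ * κ * ∑ e', Real.exp (-(κ₀ / 4 * dist e e')) := by
        refine mul_le_mul_of_nonneg_left (Finset.sum_le_sum fun e' _ => Real.exp_le_exp.mpr ?_) (by positivity)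
        have := hd0 e e'
        nlinarith
    _ ≤ 2 * θ / κ₀ * κ * L := mul_le_mul_of_nonneg_left (hL e) (by positivity)
    _ = 2 * θ * L / κ₀ * κ := by ring

end Budget

/-! ## §3 The constants and the Combes–Thomas assembly on the unit torus -/

section Constants

/-- `0 < K_D(a)` for `a > 0` and `D ≥ 1` (`K = B4Sect5Proof.latticeConst`; each factor `2/(1 − e^{−a/D})` is positive). [folklore] -/
theorem latticeConst_pos_of_pos {D : ℕ} (hD : 0 < D) {a : ℝ} (ha : 0 < a) : 0 < latticeConst D a := by
  have hD' : (0 : ℝ) < D := by exact_mod_cast hD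
  have hlt : Real.exp (-(a / D)) < 1 := by
    have h0 : (0 : ℝ) < a / D := div_pos ha hD'
    have := Real.exp_lt_exp.mpr (show -(a / D) < 0 by linarith)
    rwa [Real.exp_zero] at this
  unfold latticeConst
  exact pow_pos (mul_pos two_pos (inv_pos.mpr (by linarith))) _

/-- the coercivity constant of `S`: `γ_S(d,a′) = a′·σ₁(d+1, a′)`. [our object] -/
def gammaS (d : ℕ) (a' : ℝ) : ℝ := a' * sigma1 (d + 1) a'

/-- the torus-sum profile constant `L_S(d,a′) = K_{d+1}(κ_S/4)`. [our object] -/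
def LS (d : ℕ) (a' : ℝ) : ℝ := latticeConst (d + 1) (kappaS (d + 1) a' / 4)

/-- **the decay rate of `S⁻¹`**: `δ_S(d,a′) = min(κ_S/4, γ_S κ_S/(4 θ_S L_S))`. [our object] -/
def deltaS (d : ℕ) (a' : ℝ) : ℝ := min (kappaS (d + 1) a' / 4) (gammaS d a' * kappaS (d + 1) a' / (4 * thetaS (d + 1) a' * LS d a'))

/-- **the kernel constant of `S⁻¹`**: `σ_S(d,a′) = 2/γ_S`. [our object] -/
def sigmaS (d : ℕ) (a' : ℝ) : ℝ := 2 / gammaS d a'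

/-- **the sup-norm constant of `S⁻¹`**: `σ_∞(d,a′) = σ_S·K_{d+1}(δ_S)`. [our object] -/
def sigmaSupS (d : ℕ) (a' : ℝ) : ℝ := sigmaS d a' * latticeConst (d + 1) (deltaS d a')

variable (d)

/-- `0 < γ_S`. [folklore] -/
theorem gammaS_pos {a' : ℝ} (ha' : 0 < a') : 0 < gammaS d a' := mul_pos ha' (sigma1_pos (d := d + 1) ha')

/-- `0 < L_S`. [folklore] -/
theorem LS_pos (a' : ℝ) : 0 < LS d a' := latticeConst_pos_of_pos (Nat.succ_pos d) (by have := kappaS_pos (d + 1) a'; positivity)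

/-- `0 < δ_S`. [folklore] -/
theorem deltaS_pos {a' : ℝ} (ha' : 0 < a') : 0 < deltaS d a' := by
  have := kappaS_pos (d + 1) a'; have := gammaS_pos d ha'; have := thetaS_pos (d + 1) ha'; have := LS_pos d a'
  unfold deltaS; exact lt_min (by positivity) (by positivity)

/-- `δ_S ≤ κ_S/4`. [folklore] -/
theorem deltaS_le_quarter (a' : ℝ) : deltaS d a' ≤ kappaS (d + 1) a' / 4 := min_le_left _ _

/-- the budget at rate `δ_S` is at most `γ_S/2`. [folklore] -/
theorem budget_le_half {a' : ℝ} (ha' : 0 < a') : 2 * thetaS (d + 1) a' * LS d a' / kappaS (d + 1) a' * deltaS d a' ≤ gammaS d a' / 2 := by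
  have hκ := kappaS_pos (d + 1) a'; have hγ := gammaS_pos d ha'; have hθ := thetaS_pos (d + 1) ha'; have hL := LS_pos d a'
  have h : deltaS d a' ≤ gammaS d a' * kappaS (d + 1) a' / (4 * thetaS (d + 1) a' * LS d a') := min_le_right _ _
  calc 2 * thetaS (d + 1) a' * LS d a' / kappaS (d + 1) a' * deltaS d a'
      ≤ 2 * thetaS (d + 1) a' * LS d a' / kappaS (d + 1) a' * (gammaS d a' * kappaS (d + 1) a' / (4 * thetaS (d + 1) a' * LS d a')) :=
        mul_le_mul_of_nonneg_left h (by positivity)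
    _ = gammaS d a' / 2 := by field_simp; ring

/-- `0 < σ_S`. [folklore] -/
theorem sigmaS_pos {a' : ℝ} (ha' : 0 < a') : 0 < sigmaS d a' := div_pos two_pos (gammaS_pos d ha')

/-- `0 < σ_∞`. [folklore] -/
theorem sigmaSupS_pos {a' : ℝ} (ha' : 0 < a') : 0 < sigmaSupS d a' :=
  mul_pos (sigmaS_pos d ha') (latticeConst_pos_of_pos (Nat.succ_pos d) (deltaS_pos d ha'))

end Constants

section Assembly

variable (n : ℕ) [NeZero n] (M : Fin (d + 1) → ℕ) [hM : ∀ μ, NeZero (M μ)]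

/-- `0 ≤ ldist`. [folklore] -/
theorem ldist_nonneg (y y' : Tor M) : 0 ≤ ldist M y y' := B4Sect5Torus.tdist_nonneg _ _ _

/-- the distance-to-`y′` weight is `ldist`-Lipschitz. [folklore] -/
theorem abs_ldist_sub_ldist_le (y' e e' : Tor M) : |ldist M e y' - ldist M e' y'| ≤ ldist M e e' := by
  rw [abs_sub_le_iff]
  constructor
  · have := ldist_triangle M e e' y'; linarith
  · have := ldist_triangle M e' e y'; rw [ldist_symm M e' e] at this; linarith

/-- **conjugated coercivity of `S` at rate `δ_S` along every distance weight, with constant `γ_S/2`**. [folklore] -/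
theorem conjCoercive_Savg {a' : ℝ} (ha' : 0 < a') (y' : Tor M) (z : Tor M → ℂ) :
    gammaS d a' / 2 * nsq z ≤ (conjForm (Savg n M a') (deltaS d a') (fun e => ldist M e y') z).re := by
  have hκ := kappaS_pos (d + 1) a'; have hγ := gammaS_pos d ha'; have hθ := thetaS_pos (d + 1) ha'
  have hδ := deltaS_pos d ha'
  -- the cosh row defect at rate δ_S
  have hdef : ∀ e, ctRowDefect (Savg n M a') (deltaS d a') (fun e => ldist M e y') e
      ≤ 2 * thetaS (d + 1) a' * LS d a' / kappaS (d + 1) a' * deltaS d a' := fun e =>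
    ctRowDefect_le_of_decay_small (Savg n M a') hδ.le hκ (deltaS_le_quarter d a') hθ.le (fun e => ldist M e y') (ldist M)
      (ldist_nonneg M) (abs_ldist_sub_ldist_le M y') (fun e e' => norm_Savg_apply_le n M ha' e e')
      (fun e => sum_exp_ldist_le M e (by positivity)) e
  have hlow := conjLower_of_isHermitian (Savg n M a') (Savg_isHermitian n M a') (deltaS d a') (fun e => ldist M e y') hdef
  have hlow' := conjLower_mono hlow (budget_le_half d ha')
  have h := conjCoercive_of_conjLower (fun z => re_form_Savg_ge n M ha' z) hlow' z
  have e1 : a' * sigma1 (d + 1) a' = gammaS d a' := rfl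
  rw [e1] at h
  linarith

/-- **THE KERNEL OF `S⁻¹` IS UNIFORMLY BOUNDED AND EXPONENTIALLY LOCALISED**:
`‖(Savg n M a′)⁻¹ y y′‖ ≤ σ_S(d,a′)·e^{−δ_S(d,a′)·|y − y′|_{T₁}}` for every `n ≥ 1`, every torus `M`, every `a′ > 0`. [folklore] -/
theorem norm_Savg_inv_apply_le {a' : ℝ} (ha' : 0 < a') (y y' : Tor M) :
    ‖(Savg n M a')⁻¹ y y'‖ ≤ sigmaS d a' * Real.exp (-(deltaS d a' * ldist M y y')) := by
  have hγ := gammaS_pos d ha'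
  have h := norm_inv_apply_le (Savg n M a') (ldist M) (ldist_self M) (deltaS_pos d ha').le (half_pos hγ)
    (fun j z => conjCoercive_Savg n M ha' j z) y y'
  rw [sigmaS]
  calc ‖(Savg n M a')⁻¹ y y'‖ ≤ Real.exp (-(deltaS d a' * ldist M y y')) / (gammaS d a' / 2) := h
    _ = 2 / gammaS d a' * Real.exp (-(deltaS d a' * ldist M y y')) := by field_simp

end Assembly

/-! ## §4 The requester's currencies: `torusSupNorm ∘ rep`, `RowDecay`, the sup form -/

section Currencies

variable (n : ℕ) [NeZero n] (M : Fin (d + 1) → ℕ) [hM : ∀ μ, NeZero (M μ)]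

/-- the unit-torus distance of `TorusG0Decay` IS the `torusSupNorm` of the difference of representatives (`BlockFieldDecay`'s currency). [folklore] -/
theorem ldist_eq_torusSupNorm (y y' : Tor M) : ldist M y y' = torusSupNorm M (rep M y - rep M y') :=
  tdist_eq_torusSupNorm (fun i => Nat.one_le_iff_ne_zero.mpr (NeZero.ne (M i))) (toSite M y) (toSite M y')

/-- the kernel bound in `torusSupNorm` currency. [folklore] -/
theorem norm_Savg_inv_apply_le_tsn {a' : ℝ} (ha' : 0 < a') (y y' : Tor M) :
    ‖(Savg n M a')⁻¹ y y'‖ ≤ sigmaS d a' * Real.exp (-(deltaS d a' * torusSupNorm M (rep M y - rep M y'))) := by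
  rw [← ldist_eq_torusSupNorm]; exact norm_Savg_inv_apply_le n M ha' y y'

/-- **THE REQUESTER'S KERNEL BINDER**: `RowDecay M id id (Savg n M a′)⁻¹ σ_S δ_S` (= `hS` ∕ `hS′` of
`MinimiserOneStepDecay.fieldDecay_Mhard_succ_sub_stair`), for every `n ≥ 1` and every torus. [folklore] -/
theorem rowDecay_Savg_inv {a' : ℝ} (ha' : 0 < a') : RowDecay M id id (Savg n M a')⁻¹ (sigmaS d a') (deltaS d a') := by
  intro x y'
  have hsum : (∑ x', if id x' = y' then ‖(Savg n M a')⁻¹ x x'‖ else 0) = ‖(Savg n M a')⁻¹ x y'‖ :=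
    (Finset.sum_eq_single y' (fun b _ hb => if_neg hb) (fun h => absurd (Finset.mem_univ _) h)).trans (if_pos rfl)
  exact hsum.le.trans (norm_Savg_inv_apply_le_tsn n M ha' x y')

/-- the kernel binder at any smaller rate `0 ≤ δ ≤ δ_S` (the consumer's letters come with their own rate; `RowDecay.mono`). [folklore] -/
theorem rowDecay_Savg_inv_of_le {a' δ : ℝ} (ha' : 0 < a') (hδ : δ ≤ deltaS d a') :
    RowDecay M id id (Savg n M a')⁻¹ (sigmaS d a') δ :=
  (rowDecay_Savg_inv n M ha').mono le_rfl (sigmaS_pos d ha').le hδ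

/-- **THE REQUESTER'S SUP BINDER**: `|v| ≤ b ⟹ ‖(S⁻¹v)(y)‖ ≤ σ_∞(d,a′)·b` (= `hS` ∕ `hS′` of
`HardMinimiserOneStepSup.norm_Mhard_succ_sub_stair_le_of_letters`), for every `n ≥ 1` and every torus. [folklore] -/
theorem norm_Savg_inv_mulVec_le {a' : ℝ} (ha' : 0 < a') (v : Tor M → ℂ) (b : ℝ) (hv : ∀ y, ‖v y‖ ≤ b) (y : Tor M) :
    ‖((Savg n M a')⁻¹ *ᵥ v) y‖ ≤ sigmaSupS d a' * b := by
  have hσ := (sigmaS_pos d ha').le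
  have hb : 0 ≤ b := (norm_nonneg _).trans (hv y)
  calc ‖((Savg n M a')⁻¹ *ᵥ v) y‖ = ‖∑ y', (Savg n M a')⁻¹ y y' * v y'‖ := rfl
    _ ≤ ∑ y', ‖(Savg n M a')⁻¹ y y'‖ * ‖v y'‖ := (norm_sum_le _ _).trans (Finset.sum_le_sum fun y' _ => (norm_mul_le _ _))
    _ ≤ ∑ y', sigmaS d a' * Real.exp (-(deltaS d a' * ldist M y y')) * b :=
        Finset.sum_le_sum fun y' _ => mul_le_mul (norm_Savg_inv_apply_le n M ha' y y') (hv y') (norm_nonneg _) (by positivity)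
    _ = sigmaS d a' * b * ∑ y', Real.exp (-(deltaS d a' * ldist M y y')) := by rw [Finset.mul_sum]; exact Finset.sum_congr rfl fun _ _ => by ring
    _ ≤ sigmaS d a' * b * latticeConst (d + 1) (deltaS d a') :=
        mul_le_mul_of_nonneg_left (sum_exp_ldist_le M y (deltaS_pos d ha')) (by positivity)
    _ = sigmaSupS d a' * b := by rw [sigmaSupS]; ring

/-- **(U-SINV), KERNEL FORM, PACKAGED**: `∃ σ δ > 0` (functions of `d, a′`, chosen BEFORE `n` and `M`) with `RowDecay M id id (Savg n M a′)⁻¹ σ δ` for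
every `n ≥ 1` and every torus `M : Fin (d+1) → ℕ`. [folklore] -/
theorem exists_rowDecay_Savg_inv (d : ℕ) {a' : ℝ} (ha' : 0 < a') :
    ∃ σ δ : ℝ, 0 < σ ∧ 0 < δ ∧ ∀ (n : ℕ) [NeZero n] (M : Fin (d + 1) → ℕ) [∀ μ, NeZero (M μ)], RowDecay M id id (Savg n M a')⁻¹ σ δ :=
  ⟨sigmaS d a', deltaS d a', sigmaS_pos d ha', deltaS_pos d ha', fun n _ M _ => rowDecay_Savg_inv n M ha'⟩

/-- **(U-SINV), SUP FORM, PACKAGED**: `∃ σ > 0` (a function of `d, a′`) with `|v| ≤ b ⟹ |S⁻¹v| ≤ σ·b` for every `n ≥ 1` and every torus — in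
particular for the cubic tori `M = fun _ => N₀`, every `N₀ ≥ 1`, of the request. [folklore] -/
theorem exists_sup_Savg_inv (d : ℕ) {a' : ℝ} (ha' : 0 < a') :
    ∃ σ : ℝ, 0 < σ ∧ ∀ (n : ℕ) [NeZero n] (M : Fin (d + 1) → ℕ) [∀ μ, NeZero (M μ)] (v : Tor M → ℂ) (b : ℝ),
      (∀ y, ‖v y‖ ≤ b) → ∀ y, ‖((Savg n M a')⁻¹ *ᵥ v) y‖ ≤ σ * b :=
  ⟨sigmaSupS d a', sigmaSupS_pos d ha', fun n _ M _ v b hv y => norm_Savg_inv_mulVec_le n M ha' v b hv y⟩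

end Currencies

/-! ## §5 The requester's sup END with its two unit-lattice binders discharged -/

section HardEnd

open B5Action121 (sdiff)
open Summit.QuantumFields.BalabanUV.T4Continuum.BalabanAveragedTowerModes (par)
open Summit.QuantumFields.BalabanUV.Beta.GAN24.HardMinimiserOneStepSup (Mhard norm_Mhard_succ_sub_stair_le_of_letters)

variable (N R : ℕ) [NeZero N] [NeZero R] (M : Fin (d + 1) → ℕ) [hM : ∀ μ, NeZero (M μ)]

/-- **`HardMinimiserOneStepSup.norm_Mhard_succ_sub_stair_le_of_letters` WITH `hS`, `hS′` DISCHARGED** (`σ = σ′ = σ_∞(d, a′)`, uniform in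
the level): the all-sites one-step law of the HARD scalar minimiser now displays ONLY the five fine-lattice letters `B₁, B₂, C₁, C₂, C₀`.
Same conclusion, same constants otherwise; every torus `M : Fin (d+1) → ℕ`. [folklore] -/
theorem norm_Mhard_succ_sub_stair_le_of_letters_uniform {a' : ℝ} (ha' : 0 < a') {B₁ B₂ C₁ C₂ C₀ V : ℝ}
    (hB₁ : ∀ (μ : Fin (d + 1)) (g : Tor (fine (R * N) M) → ℂ) (b : ℝ), (∀ y, ‖g y‖ ≤ b) → ∀ x,
      ‖(Gps (R * N) M a' *ᵥ ((sdiff (fine (R * N) M) ((R * N : ℕ) : ℂ) μ)ᴴ *ᵥ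
        ((sdiff (fine (R * N) M) ((R * N : ℕ) : ℂ) μ)ᴴ *ᵥ g))) x‖ ≤ B₁ * b)
    (hB₂ : ∀ (μ : Fin (d + 1)) (g : Tor (fine (R * N) M) → ℂ) (b : ℝ), (∀ y, ‖g y‖ ≤ b) → ∀ x,
      ‖(Gps (R * N) M a' *ᵥ ((sdiff (fine (R * N) M) ((R * N : ℕ) : ℂ) μ)ᴴ *ᵥ g)) x‖ ≤ B₂ * b)
    (hC₁ : ∀ (μ : Fin (d + 1)) (f : Tor (fine N M) → ℂ) (b : ℝ), (∀ y, ‖f y‖ ≤ b) → ∀ z,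
      ‖(sdiff (fine N M) ((N : ℕ) : ℂ) μ *ᵥ (Gps N M a' *ᵥ f)) z‖ ≤ C₁ * b)
    (hC₂ : ∀ (μ : Fin (d + 1)) (f : Tor (fine N M) → ℂ) (b : ℝ), (∀ y, ‖f y‖ ≤ b) → ∀ z,
      ‖((sdiff (fine N M) ((N : ℕ) : ℂ) μ)ᴴ *ᵥ (sdiff (fine N M) ((N : ℕ) : ℂ) μ *ᵥ (Gps N M a' *ᵥ f))) z‖ ≤ C₂ * b)
    (hC₀ : ∀ (f : Tor (fine N M) → ℂ) (b : ℝ), (∀ y, ‖f y‖ ≤ b) → ∀ z, ‖(Gps N M a' *ᵥ f) z‖ ≤ C₀ * b)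
    (v : Tor M → ℂ) (hv : ∀ y, ‖v y‖ ≤ V) (x : Tor (fine (R * N) M)) :
    ‖(Mhard (R * N) M a' *ᵥ v) x - (Mhard N M a' *ᵥ v) (par N R M x)‖
      ≤ ((d + 1 : ℕ) * (((R : ℝ) - 1) / ((R : ℝ) * N)) * (a' * (B₁ * C₁ + B₂ * C₂))) * sigmaSupS d a'
        * (1 + (a' * C₀) * sigmaSupS d a') * V :=
  norm_Mhard_succ_sub_stair_le_of_letters N R M ha' hB₁ hB₂ hC₁ hC₂ hC₀
    (norm_Savg_inv_mulVec_le N M ha') (norm_Savg_inv_mulVec_le (R * N) M ha') v hv x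

end HardEnd

/-! ## §6 The typer's decls of record for row F14-SINV (cubic unit tori `M = fun _ => N₀`; `GAN24/Formal/LEAVES.md` v3.45) -/

section Cubic

/-- **σ-SUP, the typed decl of record of row F14-SINV**: ONE `σ > 0` (a function of `d, a′`) such that for every `n ≥ 1`, every `N₀ ≥ 1`
and every `v` with `|v| ≤ b`, `‖((Savg n (fun _ => N₀) a′)⁻¹ v)(y)‖ ≤ σ·b` — discharges BOTH `hS` (at `N`) and `hS′` (at `R·N`) of
`HardMinimiserOneStepSup.norm_Mhard_succ_sub_stair_le_of_letters`; the cubic case of `exists_sup_Savg_inv`. [folklore] -/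
theorem savg_inv_sup_le (d : ℕ) {a' : ℝ} (ha' : 0 < a') :
    ∃ σ : ℝ, 0 < σ ∧ ∀ (n N₀ : ℕ) [NeZero n] [NeZero N₀], 1 ≤ n →
      ∀ (v : Tor (fun _ : Fin (d + 1) => N₀) → ℂ) (b : ℝ), (∀ y, ‖v y‖ ≤ b) →
        ∀ y, ‖((Savg n (fun _ : Fin (d + 1) => N₀) a')⁻¹ *ᵥ v) y‖ ≤ σ * b :=
  ⟨sigmaSupS d a', sigmaSupS_pos d ha', fun n N₀ _ _ _ v b hv y => norm_Savg_inv_mulVec_le n (fun _ => N₀) ha' v b hv y⟩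

/-- **σ-KER, the typed decl of record of row F14-SINV**: `σ, δ > 0` (functions of `d, a′`) with
`RowDecay (fun _ => N₀) id id (Savg n (fun _ => N₀) a′)⁻¹ σ δ` for every `n ≥ 1` and every `N₀ ≥ 1` — the `hS` ∕ `hS′` binders of
`MinimiserOneStepDecay.fieldDecay_Mhard_succ_sub_stair`; the cubic case of `exists_rowDecay_Savg_inv`. [folklore] -/
theorem savg_inv_rowDecay (d : ℕ) {a' : ℝ} (ha' : 0 < a') :
    ∃ σ δ : ℝ, 0 < σ ∧ 0 < δ ∧ ∀ (n N₀ : ℕ) [NeZero n] [NeZero N₀], 1 ≤ n →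
      RowDecay (fun _ : Fin (d + 1) => N₀) id id (Savg n (fun _ : Fin (d + 1) => N₀) a')⁻¹ σ δ :=
  ⟨sigmaS d a', deltaS d a', sigmaS_pos d ha', deltaS_pos d ha', fun n N₀ _ _ _ => rowDecay_Savg_inv n (fun _ => N₀) ha'⟩

end Cubic

end Summit.QuantumFields.BalabanUV.Beta.GAN24.SavgInverseUniform

end
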